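import Mathlib
import HarnessLib
import Summits.Ventures.LatticeQCDFlow.Scoring.ReplicaChains
import Summits.Ventures.LatticeQCDFlow.Scoring.ChainConfidenceInterval

/-!
# A certified error bar from the run's own data: under `κ(x, ·) ≥ ε π`, from ANY start, the event
# "the time average misses `πf` by `≥ s` although the plug-in variance certifies `s` at level `η₀`"
# has probability at most `η₀ + 2η`

HONEST FRAMING: exact (Metropolis-corrected) sampling algorithms for lattice gauge theory;
figures of merit are autocorrelation/cost numbers at stated couplings and volumes; no
continuum-physics claim.

Venture `LatticeQCDFlow` (cell pub-lqcd), topic `Scoring`; FANOUT row 8 (`s0-cpn-nemc`, GEN-14).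
NEW WORK of the cell, not a published result; no definition is introduced.  The row's certificates
so far are either range-driven (Hoeffding: `C' = C + |πf|`, `Scoring/ChainConfidenceInterval.lean`)
or variance-driven but in terms of the UNKNOWN `Var_π f` (`Scoring/ChainMeanSquareError.lean`).
This file closes the loop with the data: the plug-in variance `V̂_N = (1/N)Σ f(X_i)² − A_N²` of
the same run estimates `Var_π f` with a certified Hoeffding radius (the confidence theorem applied
to `f` and to `f²`), and Chebyshev with the any-start mean-square error does the rest.  Inputs:
`Scoring/ChainConfidenceInterval.chain_confidence_of_doeblin`,
`Scoring/ChainMeanSquareError.chain_mse_le_of_doeblin`, `Scoring/ReplicaChains.measureReal_abs_sub_ge_le`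
(Chebyshev about a target).  Printed counterpart NAMED ONLY: empirical-Bernstein / plug-in
confidence bounds (Audibert–Munos–Szepesvári 2009; Maurer–Pontil 2009), here in the weaker
Chebyshev form but for a Markov chain from a cold start; nothing cited as a fact.

## Content (`κ` Markov, `π` invariant, `κ(x, ·) ≥ ε π`, `ε > 0`, `e = ε.toReal`; `|f| ≤ C`;
## `μ₀` ANY initial law; `N ≥ 1`; `A_N = (1/N)Σ_{i<N} f(X_i)`, `Q_N = (1/N)Σ_{i<N} f(X_i)²`,
## `V̂_N = Q_N − A_N²`; `0 < η ≤ 1`, `L = log(2/η)`; data-free radii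
## `r₁ = 8C/(eN) + √(32 C² L/(e² N))`, `r₂ = 8C²/(eN) + √(32 C⁴ L/(e² N))`, `Δ = r₂ + 2C r₁`)

* `variance_eq_integral_sq_sub` — `Var_π f = ∫ f² dπ − (πf)²`;
* `variance_le_plugin_add` — deterministic: `|A_N − πf| ≤ r₁` and `|Q_N − πf²| ≤ r₂` ⇒
  `Var_π f ≤ V̂_N + Δ`;
* **`chain_empirical_errorBar_of_doeblin`** — for every `s > 0` and `η₀ > 0`:
  `P_{μ₀}( s ≤ |A_N − πf|  ∧  (2/e − 1)(V̂_N + Δ)/N + 64 C²/(e² N²) ≤ η₀ s² ) ≤ η₀ + 2η`.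

Reading (value-free): one run, one certificate `ε`, no autocorrelation estimate and no knowledge of
`Var_π f`: whenever the printed quantity `(2/e − 1)(V̂_N + Δ)/N + 64C²/(e²N²)` is below `η₀ s²`, the
precision claim `|A_N − πf| < s` fails with probability at most `η₀ + 2η` — an error bar that is
variance-driven in its leading term and certified from a cold start.  NOT CLAIMED: any `ε` for a
concrete sampler; exponential (Bernstein) dependence on `η₀` (that needs independent streams —
`Scoring/ReplicaChains.lean`'s median — or a martingale Bernstein inequality, not here); optimal
constants; unbounded observables.
-/

noncomputable section

namespace Summit.Ventures.LatticeQCDFlow.Scoring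

open MeasureTheory ProbabilityTheory Filter Finset
open scoped ENNReal

variable {Ω : Type*} [MeasurableSpace Ω]

/-! ### Deterministic pieces -/

section Deterministic

variable {π : Measure Ω} [IsProbabilityMeasure π]

/-- `Var_π f = ∫ f² dπ − (πf)²` in the tree's `autocov … 0` form, for bounded measurable `f`. -/
theorem variance_eq_integral_sq_sub (κ : Kernel Ω Ω) {f : Ω → ℝ} (hf : Measurable f) {C : ℝ}
    (hC : ∀ x, |f x| ≤ C) :
    autocov κ π (fun y => f y - ∫ z, f z ∂π) 0 = ∫ y, f y ^ 2 ∂π - (∫ z, f z ∂π) ^ 2 := by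
  rw [autocov_zero]
  set m := ∫ z, f z ∂π with hm
  have hint : Integrable f π := integrable_of_bounded π hf hC
  have hint2 : Integrable (fun y => f y ^ 2) π :=
    integrable_of_bounded π (hf.pow_const 2) (C := C ^ 2) fun y => by
      rw [abs_pow]; exact pow_le_pow_left₀ (abs_nonneg _) (hC y) 2
  have h : (fun y => (f y - m) ^ 2) = fun y => f y ^ 2 - (2 * m) * f y + m ^ 2 := by
    funext y; ring
  have h3 : Integrable (fun y => f y ^ 2 - (2 * m) * f y) π := hint2.sub (hint.const_mul _)
  rw [h, integral_add h3 (integrable_const _),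
    integral_sub hint2 (hint.const_mul _), integral_const_mul, integral_const, probReal_univ,
    one_smul, ← hm]
  ring

omit [MeasurableSpace Ω] in
/-- **Deterministic step**: if `|A − m| ≤ r₁`, `|Q − q| ≤ r₂`, `|A| ≤ C`, `|m| ≤ C`, then
`q − m² ≤ (Q − A²) + (r₂ + 2 C r₁)`. -/
theorem variance_le_plugin_add {A Q m q r₁ r₂ C : ℝ} (hA : |A - m| ≤ r₁) (hQ : |Q - q| ≤ r₂)
    (hAC : |A| ≤ C) (hmC : |m| ≤ C) : q - m ^ 2 ≤ (Q - A ^ 2) + (r₂ + 2 * C * r₁) := by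
  have h1 : q ≤ Q + r₂ := by linarith [(abs_le.1 hQ).1]
  have h2 : |A ^ 2 - m ^ 2| ≤ 2 * C * r₁ := by
    rw [show A ^ 2 - m ^ 2 = (A - m) * (A + m) by ring, abs_mul]
    calc |A - m| * |A + m| ≤ r₁ * (2 * C) :=
          mul_le_mul hA ((abs_add_le _ _).trans (by linarith)) (abs_nonneg _)
            ((abs_nonneg _).trans hA)
      _ = 2 * C * r₁ := by ring
  linarith [(abs_le.1 h2).2]

end Deterministic

/-! ### The data-driven certificate -/

section Chain

variable {κ : Kernel Ω Ω} [IsMarkovKernel κ] {μ₀ : Measure Ω} [IsProbabilityMeasure μ₀]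
  {π : Measure Ω} [IsProbabilityMeasure π] {ε : ℝ≥0∞}

/-- **A CERTIFIED, DATA-DRIVEN ERROR BAR FROM ANY START.**  See the module docstring for the
notation; for every `s > 0`, `η₀ > 0`, `0 < η ≤ 1`, `N ≥ 1`:
`P_{μ₀}(s ≤ |A_N − πf| ∧ (2/e − 1)(V̂_N + Δ)/N + 64C²/(e²N²) ≤ η₀ s²) ≤ η₀ + 2η`. -/
theorem chain_empirical_errorBar_of_doeblin (hπ : Kernel.Invariant κ π)
    (hmin : ∀ x {B : Set Ω}, MeasurableSet B → ε * π B ≤ κ x B) (hε0 : 0 < ε)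
    {f : Ω → ℝ} (hf : Measurable f) {C : ℝ} (hC : ∀ x, |f x| ≤ C) {N : ℕ} (hN : N ≠ 0)
    {η : ℝ} (hη0 : 0 < η) (hη1 : η ≤ 1) {η₀ : ℝ} (hη₀ : 0 < η₀) {s : ℝ} (hs : 0 < s) :
    (Kernel.trajMeasure (X := fun _ : ℕ => Ω) μ₀
          (fun m : ℕ => κ.comap (fun y : (i : ↥(Finset.Iic m)) → Ω => y ⟨m, Finset.mem_Iic.2 le_rfl⟩)
            (measurable_pi_apply _))).real
        {x | s ≤ |(∑ i ∈ Finset.range N, f (x i)) / N - ∫ z, f z ∂π| ∧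
          (2 / ε.toReal - 1)
              * (((∑ i ∈ Finset.range N, f (x i) ^ 2) / N - ((∑ i ∈ Finset.range N, f (x i)) / N) ^ 2)
                + ((8 * C ^ 2 / (ε.toReal * N)
                    + Real.sqrt (32 * C ^ 4 * Real.log (2 / η) / (ε.toReal ^ 2 * N)))
                  + 2 * C * (8 * C / (ε.toReal * N)
                    + Real.sqrt (32 * C ^ 2 * Real.log (2 / η) / (ε.toReal ^ 2 * N))))) / N
            + 64 * C ^ 2 / (ε.toReal ^ 2 * (N : ℝ) ^ 2)
            ≤ η₀ * s ^ 2}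
      ≤ η₀ + 2 * η := by
  set P := Kernel.trajMeasure (X := fun _ : ℕ => Ω) μ₀
      (fun m : ℕ => κ.comap (fun y : (i : ↥(Finset.Iic m)) → Ω => y ⟨m, Finset.mem_Iic.2 le_rfl⟩)
        (measurable_pi_apply _)) with hP
  set e := ε.toReal with he
  set m := ∫ z, f z ∂π with hm
  set q := ∫ z, f z ^ 2 ∂π with hq
  set L := Real.log (2 / η) with hL
  set σ2 := autocov κ π (fun y => f y - m) 0 with hσ2
  -- the observables and their bounds
  have hf2m : Measurable fun y => f y ^ 2 := hf.pow_const 2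
  have hC0 : 0 ≤ C := by
    obtain ⟨x⟩ := nonempty_of_isProbabilityMeasure π
    exact (abs_nonneg _).trans (hC x)
  have hf2b : ∀ y, |f y ^ 2| ≤ C ^ 2 := fun y => by
    rw [abs_pow]; exact pow_le_pow_left₀ (abs_nonneg _) (hC y) 2
  have hmC : |m| ≤ C := by
    rw [hm]
    calc |∫ z, f z ∂π| = ‖∫ z, f z ∂π‖ := (Real.norm_eq_abs _).symm
      _ ≤ C * π.real Set.univ := norm_integral_le_of_norm_le_const (Eventually.of_forall fun y => by
          rw [Real.norm_eq_abs]; exact hC y)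
      _ = C := by rw [probReal_univ, mul_one]
  have hqC : |q| ≤ C ^ 2 := by
    rw [hq]
    calc |∫ z, f z ^ 2 ∂π| = ‖∫ z, f z ^ 2 ∂π‖ := (Real.norm_eq_abs _).symm
      _ ≤ C ^ 2 * π.real Set.univ := norm_integral_le_of_norm_le_const
          (Eventually.of_forall fun y => by rw [Real.norm_eq_abs]; exact hf2b y)
      _ = C ^ 2 := by rw [probReal_univ, mul_one]
  obtain ⟨-, -, -, -, -, hεr0⟩ := half_const_bounds hmin hε0
  rw [← he] at hεr0
  have hε1 := eps_le_one_of_doeblin hmin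
  have he1 : e ≤ 1 := by
    have := ENNReal.toReal_mono ENNReal.one_ne_top hε1; simpa [he] using this
  have hNpos : (0 : ℝ) < N := by exact_mod_cast Nat.pos_of_ne_zero hN
  have hL0 : 0 ≤ L := Real.log_nonneg (by rw [le_div_iff₀ hη0]; linarith)
  have hcoef : 0 ≤ 2 / e - 1 := by
    rw [sub_nonneg, le_div_iff₀ hεr0]; linarith
  -- exact radii of the confidence theorem and their data-free majorants
  set ρ₁ := 4 * (C + |m|) / (e * N) + Real.sqrt (8 * (C + |m|) ^ 2 * L / (e ^ 2 * N)) with hρ₁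
  set ρ₂ := 4 * (C ^ 2 + |q|) / (e * N) + Real.sqrt (8 * (C ^ 2 + |q|) ^ 2 * L / (e ^ 2 * N)) with hρ₂
  set r₁ := 8 * C / (e * N) + Real.sqrt (32 * C ^ 2 * L / (e ^ 2 * N)) with hr₁
  set r₂ := 8 * C ^ 2 / (e * N) + Real.sqrt (32 * C ^ 4 * L / (e ^ 2 * N)) with hr₂
  have hρr₁ : ρ₁ ≤ r₁ := by
    have h1 : 4 * (C + |m|) / (e * N) ≤ 8 * C / (e * N) :=
      div_le_div_of_nonneg_right (by linarith) (by positivity)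
    have h2 : 8 * (C + |m|) ^ 2 * L / (e ^ 2 * N) ≤ 32 * C ^ 2 * L / (e ^ 2 * N) := by
      refine div_le_div_of_nonneg_right ?_ (by positivity)
      have : (C + |m|) ^ 2 ≤ (2 * C) ^ 2 :=
        pow_le_pow_left₀ (by positivity) (by linarith) 2
      nlinarith
    exact add_le_add h1 (Real.sqrt_le_sqrt h2)
  have hρr₂ : ρ₂ ≤ r₂ := by
    have h1 : 4 * (C ^ 2 + |q|) / (e * N) ≤ 8 * C ^ 2 / (e * N) :=
      div_le_div_of_nonneg_right (by linarith) (by positivity)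
    have h2 : 8 * (C ^ 2 + |q|) ^ 2 * L / (e ^ 2 * N) ≤ 32 * C ^ 4 * L / (e ^ 2 * N) := by
      refine div_le_div_of_nonneg_right ?_ (by positivity)
      have : (C ^ 2 + |q|) ^ 2 ≤ (2 * C ^ 2) ^ 2 :=
        pow_le_pow_left₀ (by positivity) (by linarith) 2
      nlinarith
    exact add_le_add h1 (Real.sqrt_le_sqrt h2)
  -- the two bad events have probability ≤ η each
  have hB1 : P.real {x | ρ₁ < |(∑ i ∈ Finset.range N, f (x i)) / N - m|} ≤ η := by
    rw [hP, hρ₁, he, hm, hL]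
    exact chain_confidence_of_doeblin (μ₀ := μ₀) hπ hmin hε0 hf hC hN hη0 hη1
  have hB2 : P.real {x | ρ₂ < |(∑ i ∈ Finset.range N, f (x i) ^ 2) / N - q|} ≤ η := by
    rw [hP, hρ₂, he, hq, hL]
    exact chain_confidence_of_doeblin (μ₀ := μ₀) hπ hmin hε0 hf2m hf2b hN hη0 hη1
  -- the any-start mean-square error, with `C' ≤ 2C`
  have hMSE : ∫ x, ((∑ i ∈ Finset.range N, f (x i)) / N - m) ^ 2 ∂P
      ≤ (2 / e - 1) * σ2 / N + 64 * C ^ 2 / (e ^ 2 * (N : ℝ) ^ 2) := by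
    have h := chain_mse_le_of_doeblin (μ₀ := μ₀) hπ hmin hε0 hf hC hN
    rw [← hP, ← he, ← hm] at h
    refine h.trans (add_le_add le_rfl ?_)
    refine div_le_div_of_nonneg_right ?_ (by positivity)
    have : (C + |m|) ^ 2 ≤ (2 * C) ^ 2 := pow_le_pow_left₀ (by positivity) (by linarith) 2
    nlinarith
  -- Chebyshev about `πf`, any start
  have hAm : Measurable fun x : ℕ → Ω => (∑ i ∈ Finset.range N, f (x i)) / N :=
    measurable_timeAverage hf N
  have hA2 : MemLp (fun x : ℕ → Ω => (∑ i ∈ Finset.range N, f (x i)) / N) 2 P :=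
    MemLp.of_bound hAm.aestronglyMeasurable C (ae_of_all _ fun x => by
      rw [Real.norm_eq_abs]; exact abs_timeAverage_le hC hN x)
  have hCheb : P.real {x | s ≤ |(∑ i ∈ Finset.range N, f (x i)) / N - m|}
      ≤ ((2 / e - 1) * σ2 / N + 64 * C ^ 2 / (e ^ 2 * (N : ℝ) ^ 2)) / s ^ 2 :=
    (measureReal_abs_sub_ge_le hA2 m hs).trans (div_le_div_of_nonneg_right hMSE (by positivity))
  -- case analysis on the (deterministic) truth of the certificate for `σ²`
  by_cases hcert : (2 / e - 1) * σ2 / N + 64 * C ^ 2 / (e ^ 2 * (N : ℝ) ^ 2) ≤ η₀ * s ^ 2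
  · -- the claim `|A − πf| < s` fails with probability ≤ η₀
    calc P.real _ ≤ P.real {x | s ≤ |(∑ i ∈ Finset.range N, f (x i)) / N - m|} :=
          measureReal_mono (fun x hx => hx.1)
      _ ≤ ((2 / e - 1) * σ2 / N + 64 * C ^ 2 / (e ^ 2 * (N : ℝ) ^ 2)) / s ^ 2 := hCheb
      _ ≤ η₀ * s ^ 2 / s ^ 2 := div_le_div_of_nonneg_right hcert (by positivity)
      _ = η₀ := by field_simp
      _ ≤ η₀ + 2 * η := by linarith
  · -- the data certificate can only hold on a bad event
    have hsub : {x : ℕ → Ω | s ≤ |(∑ i ∈ Finset.range N, f (x i)) / N - m| ∧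
          (2 / e - 1) * (((∑ i ∈ Finset.range N, f (x i) ^ 2) / N
              - ((∑ i ∈ Finset.range N, f (x i)) / N) ^ 2) + (r₂ + 2 * C * r₁)) / N
            + 64 * C ^ 2 / (e ^ 2 * (N : ℝ) ^ 2) ≤ η₀ * s ^ 2}
        ⊆ {x | ρ₁ < |(∑ i ∈ Finset.range N, f (x i)) / N - m|}
          ∪ {x | ρ₂ < |(∑ i ∈ Finset.range N, f (x i) ^ 2) / N - q|} := by
      intro x hx
      by_contra hgood
      simp only [Set.mem_union, Set.mem_setOf_eq, not_or, not_lt] at hgood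
      obtain ⟨hg1, hg2⟩ := hgood
      have hAx : |(∑ i ∈ Finset.range N, f (x i)) / N| ≤ C := abs_timeAverage_le hC hN x
      have hdet := variance_le_plugin_add (hg1.trans hρr₁) (hg2.trans hρr₂) hAx hmC
      -- `σ² = q − m²`
      have hσ : σ2 = q - m ^ 2 := by
        rw [hσ2, hq, hm]; exact variance_eq_integral_sq_sub κ hf hC
      have hmono : (2 / e - 1) * σ2 / N + 64 * C ^ 2 / (e ^ 2 * (N : ℝ) ^ 2)
          ≤ (2 / e - 1) * (((∑ i ∈ Finset.range N, f (x i) ^ 2) / N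
              - ((∑ i ∈ Finset.range N, f (x i)) / N) ^ 2) + (r₂ + 2 * C * r₁)) / N
            + 64 * C ^ 2 / (e ^ 2 * (N : ℝ) ^ 2) := by
        refine add_le_add (div_le_div_of_nonneg_right
          (mul_le_mul_of_nonneg_left ?_ hcoef) hNpos.le) le_rfl
        rw [hσ]; exact hdet
      exact hcert (hmono.trans hx.2)
    calc P.real _ ≤ P.real ({x | ρ₁ < |(∑ i ∈ Finset.range N, f (x i)) / N - m|}
            ∪ {x | ρ₂ < |(∑ i ∈ Finset.range N, f (x i) ^ 2) / N - q|}) := measureReal_mono hsub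
      _ ≤ P.real {x | ρ₁ < |(∑ i ∈ Finset.range N, f (x i)) / N - m|}
            + P.real {x | ρ₂ < |(∑ i ∈ Finset.range N, f (x i) ^ 2) / N - q|} :=
          measureReal_union_le _ _
      _ ≤ η + η := add_le_add hB1 hB2
      _ ≤ η₀ + 2 * η := by linarith

end Chain

end Summit.Ventures.LatticeQCDFlow.Scoring

end
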